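import Summits.QuantumFields.YangMills.Theses.LangevinControlUV
import Summits.QuantumFields.YangMills.Theorems.OneCertifiedCubeFiniteSizeCriterion

/-!
# Crux `LatticeGapInUVUnitsC` (stmt-QuantumFields-16206): reduction to a total-variation finite-size certificate

Support file for item stmt-QuantumFields-16206 (route `LangevinControlUV` of `YangMills`), line lead
prover-line-stmt-QuantumFields-16206-c3-0 (2026-08-17).  The crux (femto two-point package in CONTINUOUS units ⇒
volume-uniform clustering of all gauge-invariant local observables at rate `c₁ a(β)`) is here reduced, kernel-checked and
DEF-FREE, to ONE finite-size certificate of Dobrushin–Shlosman type: for continuous package rulers `a`, the Wilson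
specification `ymSpecification r.ρ β` satisfies the total-variation finite-size condition of route `OneCertifiedCube`
(window `n`, threshold `ε` with `ε·M(n) < 1`, `M(n) = (4n+3)⁴ − (4n+1)⁴`) at the cell size `⌈ℓ / a β⌉₊` of ONE
physical length `ℓ`, for all `β ≥ β₂`.  The infinite-volume step is the tree's PROVED universal-threshold criterion
`Summit.QuantumFields.YangMills.Theorems.FiniteSizeCriterion_proof` (item stmt-QuantumFields-8895: Dobrushin–Shlosman
block recursion on mesh-`b` cells, chain rule, torus DLR transfer), which turns the condition at cell `b` into clustering
`C(A,B) e^{−κ t / b}` on every torus of side `2S+1 ≥ (8n+7) b`, `κ = κ(n, ε)`, `C(A,B)` independent of `β, b, S, t`;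
`a → 0` is load-bearing exactly at `⌈ℓ/aβ⌉₊ · aβ ≤ 2ℓ` (rate `c₁ = κ/(2ℓ)`), and `S₁ β = (8n+7)⌈ℓ/aβ⌉₊`.

The certificate hypothesis of `latticeGapInUVUnitsC_of_tvFiniteSize` is, clause for clause, the condition of the crux
`Summit.QuantumFields.YangMills.Theses.OneCertifiedCube.CrossoverCertificate` (stmt-QuantumFields-16125) with the
scheme data `(sch.β k, sch.a k)` replaced by `(β, a β)` for a continuous package ruler and "eventually in `k`" by
"for all `β ≥ β₂`"; it is fed the package (standing Disproof §2: a certificate quantified over all continuous rulers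
without the package is unsatisfiable modulo `XiUnbounded`).  No definition is introduced; every statement is written out.  `stub_tvTransfer` is stub S5 of the registered skeleton v5
(verbatim signature); `latticeGapInUVUnitsC_of_tvFiniteSize` is the def-free one-hypothesis form (certificate ⇒ crux BY NAME).

References: R. L. Dobrushin, S. B. Shlosman, *Constructive criterion for the uniqueness of Gibbs field* (1985), §2;
F. Martinelli, *Lectures on Glauber dynamics for discrete spin models*, LNM 1717 (1999), §2.3.
-/

open scoped BigOperators
open MeasureTheory Filter Topology
open Literature.MathematicalPhysics.QuantumFieldTheory Literature.MathematicalPhysics.QuantumLattice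
open Summit.QuantumFields.YangMills.Theses.LangevinControlUV

noncomputable section

namespace Summit.QuantumFields.YangMills.Theorems.LatticeGapInUVUnitsC.FiniteSize

section Pipeline

variable {G : Type} [Group G] [TopologicalSpace G] [IsTopologicalGroup G] [CompactSpace G]
  [MeasurableSpace G] [BorelSpace G]

/-- **TV finite-size condition at the physical cell `ℓ` + `a → 0` ⇒ clustering in the units of `a`.**  If for all
`β ≥ β₂` the Wilson specification `ymSpecification r.ρ β` satisfies the Dobrushin–Shlosman total-variation finite-size
condition at window `n`, threshold `ε` (`ε M(n) < 1`) and cell `⌈ℓ / a β⌉₊`, then all pairs of gauge-invariant local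
observables cluster at rate `(κ/(2ℓ)) a(β) n` on every torus of side `2S+1` with `S ≥ (8n+7)⌈ℓ/aβ⌉₊`, `n ≤ S`, with
per-pair constants independent of `β` (from `FiniteSizeCriterion_proof`); `⌈ℓ/aβ⌉₊ aβ ≤ ℓ + aβ ≤ 2ℓ` once `aβ ≤ ℓ`. -/
theorem concl_of_tvFiniteSize (r : LatticeRep G) {a : ℝ → ℝ} (hpos : ∀ β, 0 < a β)
    (hlim : Tendsto a atTop (𝓝 0)) {ℓ : ℝ} (hℓ : 0 < ℓ) {n : ℕ} {ε : ℝ} (hn : 1 ≤ n) (hε : 0 ≤ ε)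
    (hM : ε * ((((4 * n + 3) ^ 4 - (4 * n + 1) ^ 4 : ℕ)) : ℝ) < 1) {β₂ : ℝ}
    (hFS : ∀ β : ℝ, β₂ ≤ β → (∀ w : Fin 4 → ℤ → ℤ, (∀ i j, w i j + ((⌈ℓ / a β⌉₊ : ℕ) : ℤ) ≤ w i (j + 1) ∧ w i (j + 1) ≤ w i j + 2 * ((⌈ℓ / a β⌉₊ : ℕ) : ℤ)) → ∀ Y : Finset (Fin 4 → ℤ), Y ⊆ (Fintype.piFinset fun _ : Fin 4 => Finset.Icc (-(2 * ((n : ℕ) : ℤ))) (2 * ((n : ℕ) : ℤ))) → (0 : Fin 4 → ℤ) ∈ Y → ∀ η η' : LGConfig 4 G, (∀ e ∈ (Fintype.piFinset fun _ : Fin 4 => Finset.Icc (-(2 * ((n : ℕ) : ℤ))) (2 * ((n : ℕ) : ℤ))).biUnion (fun y : Fin 4 → ℤ => (Fintype.piFinset fun i : Fin 4 => Finset.Ico (w i (y i)) (w i (y i + 1))) ×ˢ (Finset.univ : Finset (Fin 4))), η e = η' e) → ∀ f : LGConfig 4 G → ℝ, IsCylinder f ((fun y : Fin 4 → ℤ =>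 (Fintype.piFinset fun i : Fin 4 => Finset.Ico (w i (y i)) (w i (y i + 1))) ×ˢ (Finset.univ : Finset (Fin 4))) 0) → Measurable f → (∀ U, 0 ≤ f U ∧ f U ≤ 1) → |(∫ U, f U ∂(ymSpecification r.ρ β (Y.biUnion (fun y : Fin 4 → ℤ => (Fintype.piFinset fun i : Fin 4 => Finset.Ico (w i (y i)) (w i (y i + 1))) ×ˢ (Finset.univ : Finset (Fin 4)))) η)) - ∫ U, f U ∂(ymSpecification r.ρ β (Y.biUnion (fun y : Fin 4 → ℤ => (Fintype.piFinset fun i : Fin 4 => Finset.Ico (w i (y i)) (w i (y i + 1))) ×ˢ (Finset.univ : Finset (Fin 4)))) η')| ≤ ε)) :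
    ∃ (c₁ β₂ : ℝ) (S₁ : ℝ → ℕ), 0 < c₁ ∧ ∀ A B : YMSpecies G, ∃ C : ℝ, ∀ β : ℝ, β₂ ≤ β → ∀ S n : ℕ, S₁ β ≤ S → n ≤ S → |latticeConnectedCorr r.ρ β (2 * S + 1) A.F B.F n| ≤ C * Real.exp (-(c₁ * a β * n)) := by
  obtain ⟨κ, hκ, hF⟩ := Summit.QuantumFields.YangMills.Theorems.FiniteSizeCriterion_proof n ε hn hε hM
  have hAB := hF G r.N r.ρ r.continuous r.injective
  obtain ⟨β₃, hβ₃⟩ := eventually_atTop.1 (hlim (Iio_mem_nhds hℓ))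
  refine ⟨κ / (2 * ℓ), max β₂ β₃, fun β => (8 * n + 7) * ⌈ℓ / a β⌉₊, by positivity, fun A B => ?_⟩
  obtain ⟨C, hC⟩ := hAB A B
  refine ⟨max C 0, fun β hβ S t hS ht => ?_⟩
  have hβ2 : β₂ ≤ β := (le_max_left _ _).trans hβ
  have haℓ : a β < ℓ := hβ₃ β ((le_max_right _ _).trans hβ)
  have hq : 0 < ℓ / a β := div_pos hℓ (hpos β)
  have hb1 : 1 ≤ ⌈ℓ / a β⌉₊ := Nat.one_le_iff_ne_zero.2 (Nat.ceil_pos.2 hq).ne'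
  have hside : (8 * n + 7) * ⌈ℓ / a β⌉₊ ≤ 2 * S + 1 := hS.trans (by omega)
  refine (hC β ⌈ℓ / a β⌉₊ hb1 (hFS β hβ2) S hside t ht).trans ?_
  have hbR : ((⌈ℓ / a β⌉₊ : ℕ) : ℝ) < ℓ / a β + 1 := Nat.ceil_lt_add_one hq.le
  have hba : ((⌈ℓ / a β⌉₊ : ℕ) : ℝ) * a β ≤ 2 * ℓ := by
    have h1 : ((⌈ℓ / a β⌉₊ : ℕ) : ℝ) * a β < (ℓ / a β + 1) * a β := mul_lt_mul_of_pos_right hbR (hpos β)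
    have h2 : (ℓ / a β + 1) * a β = ℓ + a β := by
      rw [add_mul, one_mul, div_mul_cancel₀ ℓ (hpos β).ne']
    linarith
  have hbpos : (0 : ℝ) < ((⌈ℓ / a β⌉₊ : ℕ) : ℝ) := by exact_mod_cast hb1
  have ht0 : (0 : ℝ) ≤ t := Nat.cast_nonneg t
  have hrate : κ / (2 * ℓ) * a β ≤ κ / (⌈ℓ / a β⌉₊ : ℕ) := by
    rw [div_mul_eq_mul_div, div_le_div_iff₀ (by positivity) hbpos]
    calc κ * a β * ((⌈ℓ / a β⌉₊ : ℕ) : ℝ) = κ * (((⌈ℓ / a β⌉₊ : ℕ) : ℝ) * a β) := by ring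
      _ ≤ κ * (2 * ℓ) := mul_le_mul_of_nonneg_left hba hκ.le
  have key : κ / (2 * ℓ) * a β * t ≤ κ * t / (⌈ℓ / a β⌉₊ : ℕ) :=
    calc κ / (2 * ℓ) * a β * t ≤ κ / (⌈ℓ / a β⌉₊ : ℕ) * t := mul_le_mul_of_nonneg_right hrate ht0
      _ = κ * t / (⌈ℓ / a β⌉₊ : ℕ) := by ring
  calc C * Real.exp (-(κ * t / (⌈ℓ / a β⌉₊ : ℕ))) ≤ max C 0 * Real.exp (-(κ * t / (⌈ℓ / a β⌉₊ : ℕ))) :=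
        mul_le_mul_of_nonneg_right (le_max_left _ _) (Real.exp_pos _).le
    _ ≤ max C 0 * Real.exp (-(κ / (2 * ℓ) * a β * t)) :=
        mul_le_mul_of_nonneg_left (Real.exp_le_exp.2 (neg_le_neg key)) (le_max_right _ _)

end Pipeline

/-- **S5 `stub_tvTransfer` of the registered skeleton v5** (`Cruxes/LatticeGapInUVUnitsC/Lines/nested_shell_rho_mixing.lean`,
namespace `…Cruxes.LatticeGapInUVUnitsC.FiniteSize`), registered signature verbatim: the TV finite-size condition at
`(ℓ, n, ε)` for all `β ≥ β₂` at cell `⌈ℓ/aβ⌉₊`, plus `a > 0` and `a → 0`, give the crux's conclusion (per-pair constants,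
rate `(κ/(2ℓ)) a β`).  Proof: `concl_of_tvFiniteSize`. -/
theorem stub_tvTransfer : ∀ (G : Type) [Group G] [TopologicalSpace G] [IsTopologicalGroup G] [CompactSpace G] [MeasurableSpace G] [BorelSpace G] (r : LatticeRep G) (a : ℝ → ℝ) (ℓ : ℝ) (n : ℕ) (ε β₂ : ℝ), (∀ β, 0 < a β) → Filter.Tendsto a Filter.atTop (nhds 0) → 0 < ℓ → 1 ≤ n → 0 ≤ ε → ε * ((((4 * n + 3) ^ 4 - (4 * n + 1) ^ 4 : ℕ)) : ℝ) < 1 → (∀ β : ℝ, β₂ ≤ β → (∀ w : Fin 4 → ℤ → ℤ, (∀ i j, w i j + ((⌈ℓ / a β⌉₊ : ℕ) : ℤ) ≤ w i (j + 1) ∧ w i (j + 1) ≤ w i j + 2 * ((⌈ℓ / a β⌉₊ : ℕ) : ℤ)) → ∀ Y : Finset (Fin 4 → ℤ), Y ⊆ (Fintype.piFinset fun _ : Fin 4 => Finset.Icc (-(2 * ((n : ℕ) : ℤ))) (2 * ((n : ℕ) : ℤ))) → (0 : Fin 4 → ℤ) ∈ Y → ∀ η η' : LGConfig 4 G, (∀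 e ∈ (Fintype.piFinset fun _ : Fin 4 => Finset.Icc (-(2 * ((n : ℕ) : ℤ))) (2 * ((n : ℕ) : ℤ))).biUnion (fun y : Fin 4 → ℤ => (Fintype.piFinset fun i : Fin 4 => Finset.Ico (w i (y i)) (w i (y i + 1))) ×ˢ (Finset.univ : Finset (Fin 4))), η e = η' e) → ∀ f : LGConfig 4 G → ℝ, IsCylinder f ((fun y : Fin 4 → ℤ => (Fintype.piFinset fun i : Fin 4 => Finset.Ico (w i (y i)) (w i (y i + 1))) ×ˢ (Finset.univ : Finset (Fin 4))) 0) → Measurable f → (∀ U, 0 ≤ f U ∧ f U ≤ 1) → |(∫ U, f U ∂(ymSpecification r.ρ β (Y.biUnion (fun y : Fin 4 → ℤ => (Fintype.piFinset fun i : Fin 4 => Finset.Ico (w i (y i)) (w i (y i + 1))) ×ˢ (Finset.univ : Finset (Fin 4)))) η)) - ∫ U, f U ∂(ymSpecification r.ρ β (Y.biUnion (fun y : Fin 4 → ℤ => (Fintype.piFinset fun i : Fin 4 => Finset.Ico (w i (y i)) (w i (y i + 1))) ×ˢ (Finset.univ : Finset (Fin 4)))) η')| ≤ ε)) → ∃ (c₁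 β₂ : ℝ) (S₁ : ℝ → ℕ), 0 < c₁ ∧ ∀ A B : YMSpecies G, ∃ C : ℝ, ∀ β : ℝ, β₂ ≤ β → ∀ S t : ℕ, S₁ β ≤ S → t ≤ S → |latticeConnectedCorr r.ρ β (2 * S + 1) A.F B.F t| ≤ C * Real.exp (-(c₁ * a β * t)) := by
  intro G _ _ _ _ _ _ r a ℓ n ε β₂ hpos hlim hℓ hn hε hM hFS
  exact concl_of_tvFiniteSize r hpos hlim hℓ hn hε hM hFS


/-- **The crux from ONE total-variation finite-size certificate, def-free**: if every continuous package ruler `a`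
(compact simple `G`, faithful `r`) admits a physical length `ℓ > 0`, a window `n ≥ 1` and a threshold `ε ≥ 0` with
`ε M(n) < 1` such that for all `β ≥ β₂` the Wilson specification at `β` satisfies the TV finite-size condition of route
`OneCertifiedCube` at cell `⌈ℓ / a β⌉₊` (the condition of `CrossoverCertificate`, stmt-QuantumFields-16125, re-parametrised
by `(β, a β)`), then `LatticeGapInUVUnitsC` holds BY NAME — through the proved criterion `FiniteSizeCriterion_proof`. -/
theorem latticeGapInUVUnitsC_of_tvFiniteSize (hCert : ∀ (G : Type) [Group G] [TopologicalSpace G] [IsTopologicalGroup G] [CompactSpace G], IsCompactSimpleLieGroup G → letI : MeasurableSpace G := borel G; haveI : BorelSpace G := ⟨rfl⟩; ∀ (r : LatticeRep G) (a : ℝ → ℝ), Continuous a → (∃ (Γ : ℝ → ℝ) (β₀ ℓ₀ c C : ℝ), 0 < ℓ₀ ∧ 0 < c ∧ (∀ β, 0 < a β) ∧ Filter.Tendsto a Filter.atTop (nhds 0) ∧ (∀ s : ℝ, 0 < s → s ≤ ℓ₀ → 0 < Γ s ∧ Γ s ≤ 1) ∧ ∀ (L : ℕ) [NeZero L] (β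 : ℝ), β₀ ≤ β → (L : ℝ) * a β ≤ ℓ₀ → let P : (Fin 4 → ZMod L) → Fin 4 → Fin 4 → GaugeConfig 4 L G → ℝ := fun x i j U => (r.N : ℝ) - (r.ρ (plaquetteHolonomy U x i j)).trace.re; let E : (GaugeConfig 4 L G → ℝ) → ℝ := fun F => wilsonExpectation (d := 4) (L := L) r.ρ β F; let cov : (GaugeConfig 4 L G → ℝ) → (GaugeConfig 4 L G → ℝ) → ℝ := fun F F' => E (fun U => F U * F' U) - E F * E F'; let dist : (Fin 4 → ZMod L) → (Fin 4 → ZMod L) → ℝ := fun x y => Real.sqrt (∑ k : Fin 4, (((x k - y k).valMinAbs : ℤ) : ℝ) ^ 2); (∀ n : ℕ, 1 ≤ n → 8 * n ≤ L → c * Γ ((n : ℝ) * a β) ≤ (n : ℝ) ^ 8 * cov (P 0 0 1) (P (Pi.single (2 : Fin 4) ((n : ℕ) : ZMod L)) 0 1) ∧ (n : ℝ) ^ 8 * cov (P 0 0 1) (P (Pi.single (2 : Fin 4) ((n : ℕ) : ZMod L)) 0 1) ≤ C * Γ ((n : ℝ) * a β)) ∧ (∀ (x y : Fin 4 → ZMod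 L) (i j i' j' : Fin 4), x ≠ y → i ≠ j → i' ≠ j' → |cov (P x i j) (P y i' j')| * dist x y ^ 8 ≤ C * Γ (dist x y * a β))) → ∃ ℓ : ℝ, 0 < ℓ ∧ ∃ (n : ℕ) (ε : ℝ), 1 ≤ n ∧ 0 ≤ ε ∧ ε * ((((4 * n + 3) ^ 4 - (4 * n + 1) ^ 4 : ℕ)) : ℝ) < 1 ∧ ∃ β₂ : ℝ, ∀ β : ℝ, β₂ ≤ β → (∀ w : Fin 4 → ℤ → ℤ, (∀ i j, w i j + ((⌈ℓ / a β⌉₊ : ℕ) : ℤ) ≤ w i (j + 1) ∧ w i (j + 1) ≤ w i j + 2 * ((⌈ℓ / a β⌉₊ : ℕ) : ℤ)) → ∀ Y : Finset (Fin 4 → ℤ), Y ⊆ (Fintype.piFinset fun _ : Fin 4 => Finset.Icc (-(2 * ((n : ℕ) : ℤ))) (2 * ((n : ℕ) : ℤ))) → (0 : Fin 4 → ℤ) ∈ Y → ∀ η η' : LGConfig 4 G, (∀ e ∈ (Fintype.piFinset fun _ : Fin 4 => Finset.Icc (-(2 * ((n : ℕ) : ℤ))) (2 * ((n : ℕ)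 : ℤ))).biUnion (fun y : Fin 4 → ℤ => (Fintype.piFinset fun i : Fin 4 => Finset.Ico (w i (y i)) (w i (y i + 1))) ×ˢ (Finset.univ : Finset (Fin 4))), η e = η' e) → ∀ f : LGConfig 4 G → ℝ, IsCylinder f ((fun y : Fin 4 → ℤ => (Fintype.piFinset fun i : Fin 4 => Finset.Ico (w i (y i)) (w i (y i + 1))) ×ˢ (Finset.univ : Finset (Fin 4))) 0) → Measurable f → (∀ U, 0 ≤ f U ∧ f U ≤ 1) → |(∫ U, f U ∂(ymSpecification r.ρ β (Y.biUnion (fun y : Fin 4 → ℤ => (Fintype.piFinset fun i : Fin 4 => Finset.Ico (w i (y i)) (w i (y i + 1))) ×ˢ (Finset.univ : Finset (Fin 4)))) η)) - ∫ U, f U ∂(ymSpecification r.ρ β (Y.biUnion (fun y : Fin 4 → ℤ => (Fintype.piFinset fun i : Fin 4 => Finset.Ico (w i (y i)) (w i (y i + 1))) ×ˢ (Finset.univ : Finset (Fin 4)))) η')| ≤ ε)) : LatticeGapInUVUnitsC := by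
  intro G _ _ _ _ hG
  letI : MeasurableSpace G := borel G
  haveI : BorelSpace G := ⟨rfl⟩
  intro r a ha hP
  obtain ⟨ℓ, hℓ, n, ε, hn, hε, hM, β₂, hFS⟩ := hCert G hG r a ha hP
  obtain ⟨Γ, β₀, ℓ₀, c, C, -, -, hpos, hlim, -, -⟩ := hP
  exact concl_of_tvFiniteSize r hpos hlim hℓ hn hε hM hFS

end Summit.QuantumFields.YangMills.Theorems.LatticeGapInUVUnitsC.FiniteSize

end
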